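import Literature.Barriers.HodgeConjecture.ConjugateVarietiesSerreFermatProofs
import Literature.Barriers.HodgeConjecture.ConjugateVarietiesSerreTwentyThreeProofs
import Literature.AlgebraicGeometry.HodgeTheory.FermatHypersurfaceReduction
import Literature.AlgebraicGeometry.Motives.ComplexPointsManifold
import HarnessLib

/-!
# Serre 1964, no. 2: the `ℤ/p`-action on the complex points of `Y = {Σ xᵢᵖ = 0}` as data

Companion to `ConjugateVarietiesSerreFermatProofs.lean` ("`G` opère librement": no non-trivial
power of the cyclic shift fixes a complex point of the Fermat hypersurface `Σ_{i<p} xᵢᵐ = 0`,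
`p = n + 2` prime, `p ∣ m`) and to `ConjugateVarietiesSerreTwentyThreeProofs.lean`
(`serre1964_twentyThree_of_latticeModels`: the barrier fact `Serre1964_conjugateVarieties_notHomeomorphic`
from lattice models `(Y × V/L)/G` of `V_φ(ℂ)`, `V_ψ(ℂ)`, whose factor `Y` is a simply connected
locally compact Hausdorff space with a free continuous action of a group of order `23`).  Here the
factor is specialised to SERRE'S `Y` (no. 2: "soit `Y` l'hypersurface d'équation homogène
`Σ_{i=1}^{p} Xᵢᵖ = 0` … faisons opérer `G` sur `Y` par permutation circulaire des coordonnées"):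

* `shiftPerm g = σ^{g}` (`σ` the cyclic shift of `Fin (n + 2)`, `g ∈ ℤ/(n+2)`), a group
  homomorphism (`shiftPerm_one`, `shiftPerm_mul`, since `σ^{n+2} = 1`);
* `fermatShiftAction n m` — the action of `G = ℤ/(n+2)` (as `Multiplicative (ZMod (n + 2))`) on
  `Y(ℂ) = ComplexPoints (fermatHypersurface n m)` by the tree's `HodgeTheory.permMap` (an instance;
  `fermatShift_smul_def`), continuous (`continuousConstSMul_fermatShift`)
  and, for `n + 2` prime dividing `m`, FREE (`fermatShift_eq_one_of_smul_eq`,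
  from `permMap_finRotate_pow_ne`);
* `compactSpace_/t2Space_/locallyCompactSpace_complexPoints_fermatHypersurface` — `Y(ℂ)` is compact
  Hausdorff (`Y` is smooth projective, the tree's `isSmoothProjective_fermatHypersurface`, and
  `ComplexPoints.compactSpace_of_isSmoothProjective`, `t2Space_of_isSmoothProjective`);
* `serre1964_twentyThree_of_fermatLatticeModels` — `serre1964_twentyThree_of_latticeModels` with
  `Y₁ = Y₂ = Y(ℂ)` for Serre's `Y ⊂ ℙ²²` of degree `23` and `G = ℤ/23` acting by the shift: of the
  hypotheses on `Y` only its SIMPLE CONNECTIVITY ("en vertu d'un théorème de Lefschetz") is left.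

No named facts are introduced (the only definitions are the permutation `shiftPerm` and the action
instance `fermatShiftAction`, genuine definitions with bodies).

## References

* [Serre1964Conjugate] J.-P. Serre, C. R. Acad. Sci. Paris 258 (1964) 4194–4196, no. 2 (p. 4195).
* [Shioda1979HodgeFermat] T. Shioda, Math. Ann. 245 (1979), §1 (symmetries of the Fermat variety).
-/

noncomputable section

open CategoryTheory AlgebraicGeometry Multiplicative
open Literature.AlgebraicGeometry.Motives Literature.AlgebraicGeometry.HodgeTheory

namespace Literature.Barriers.HodgeConjecture.Serre1964

/-! ### The cyclic shift as a homomorphism `ℤ/(n+2) → 𝔖_{n+2}` -/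

/-- The power `σ^g` of the cyclic shift `σ` of `Fin (n + 2)` attached to `g ∈ ℤ/(n+2)` (through
the representative `0 ≤ g.val < n + 2`). [cite: Serre1964Conjugate, no. 2 (p. 4195)] -/
def shiftPerm {n : ℕ} (g : Multiplicative (ZMod (n + 2))) : Equiv.Perm (Fin (n + 2)) :=
  finRotate (n + 2) ^ (toAdd g).val

open Fin.CommRing in
/-- The cyclic shift of `Fin (n + 2)` has order dividing `n + 2`: `σ^{n+2} = 1`. [folklore] -/
theorem finRotate_pow_card_eq_one (n : ℕ) : finRotate (n + 2) ^ (n + 2) = 1 := by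
  ext i : 1
  rw [finRotate_pow_apply, Fin.natCast_self, add_zero, Equiv.Perm.coe_one, id]

/-- `σ^{x mod (n+2)} = σ^x`. [folklore] -/
theorem finRotate_pow_mod (n x : ℕ) : finRotate (n + 2) ^ (x % (n + 2)) = finRotate (n + 2) ^ x := by
  conv_rhs => rw [← Nat.mod_add_div x (n + 2), pow_add, pow_mul, finRotate_pow_card_eq_one,
    one_pow, mul_one]

/-- `shiftPerm 1 = 1`. [folklore] -/
@[simp] theorem shiftPerm_one {n : ℕ} : shiftPerm (1 : Multiplicative (ZMod (n + 2))) = 1 := by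
  simp [shiftPerm]

/-- `shiftPerm (ofAdd a) = σ^{a.val}`. [folklore] -/
theorem shiftPerm_ofAdd {n : ℕ} (a : ZMod (n + 2)) : shiftPerm (ofAdd a) = finRotate (n + 2) ^ a.val :=
  rfl

/-- `shiftPerm` is multiplicative (the shift has order `n + 2`). [folklore] -/
theorem shiftPerm_mul {n : ℕ} (g h : Multiplicative (ZMod (n + 2))) :
    shiftPerm (g * h) = shiftPerm g * shiftPerm h := by
  simp only [shiftPerm, toAdd_mul, ZMod.val_add, ← pow_add, finRotate_pow_mod]

/-! ### The action on `Y(ℂ)` -/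

variable (n m : ℕ)

/-- Congruence of `permMap` in the permutation. [folklore] -/
theorem permMap_congr {F : MvPolynomial (Fin (n + 2)) ℂ} {π π' : Equiv.Perm (Fin (n + 2))}
    (h : π = π') (hπ : π ∈ permStabilizer F) (hπ' : π' ∈ permStabilizer F) :
    permMap F hπ = permMap F hπ' := by
  subst h
  rfl

/-- **Serre's action of `G = ℤ/(n+2)` on `Y(ℂ)`**, `Y = {Σ xᵢᵐ = 0} ⊂ ℙⁿ⁺¹_ℂ` the Fermat
hypersurface (`HodgeTheory.fermatHypersurface n m`), by cyclic permutation of the coordinates: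
`g • [z] = [z ∘ σ^g]` (the tree's `permMap`). [cite: Serre1964Conjugate, no. 2 (p. 4195)] -/
instance fermatShiftAction : MulAction (Multiplicative (ZMod (n + 2))) (ComplexPoints (fermatHypersurface n m)) where
  smul g x := permMap (fermatPolynomial ℂ n m) (mem_permStabilizer_fermatPolynomial m (shiftPerm g)) x
  one_smul x := by
    change permMap (fermatPolynomial ℂ n m) (mem_permStabilizer_fermatPolynomial m (shiftPerm 1)) x = x
    rw [permMap_congr n shiftPerm_one _ (one_mem _), permMap_one]
    rfl
  mul_smul g h x := by
    change permMap (fermatPolynomial ℂ n m) (mem_permStabilizer_fermatPolynomial m (shiftPerm (g * h))) x =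
      permMap (fermatPolynomial ℂ n m) (mem_permStabilizer_fermatPolynomial m (shiftPerm g))
        (permMap (fermatPolynomial ℂ n m) (mem_permStabilizer_fermatPolynomial m (shiftPerm h)) x)
    rw [permMap_congr n ((congrArg shiftPerm (mul_comm g h)).trans (shiftPerm_mul h g)) _
      (mul_mem (mem_permStabilizer_fermatPolynomial m (shiftPerm h))
        (mem_permStabilizer_fermatPolynomial m (shiftPerm g))), permMap_mul]
    rfl


/-- Unfolding the action: `g • x = permMap (σ^g) x`. [folklore] -/
theorem fermatShift_smul_def (g : Multiplicative (ZMod (n + 2))) (x : ComplexPoints (fermatHypersurface n m)) :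
    g • x = permMap (fermatPolynomial ℂ n m) (mem_permStabilizer_fermatPolynomial m (shiftPerm g)) x :=
  rfl

/-- The action is by homeomorphisms, in particular continuous in the point. [folklore] -/
instance continuousConstSMul_fermatShift :
    ContinuousConstSMul (Multiplicative (ZMod (n + 2))) (ComplexPoints (fermatHypersurface n m)) :=
  ⟨fun g ↦ (permMap (fermatPolynomial ℂ n m)
    (mem_permStabilizer_fermatPolynomial m (shiftPerm g))).continuous⟩

variable {n m}

/-- **"`G` opère librement"** (Serre 1964, no. 2): for `n + 2` prime dividing `m`, the action of
`ℤ/(n+2)` on `Y(ℂ)` is free. [cite: Serre1964Conjugate, no. 2 (p. 4195)] -/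
theorem fermatShift_eq_one_of_smul_eq (hp : (n + 2).Prime) (hm : n + 2 ∣ m)
    (g : Multiplicative (ZMod (n + 2))) (x : ComplexPoints (fermatHypersurface n m))
    (h : g • x = x) : g = 1 := by
  by_contra hg
  haveI : NeZero (n + 2) := ⟨by omega⟩
  have ha : (toAdd g).val ≠ 0 := fun h0 ↦ hg (toAdd.injective ((ZMod.val_eq_zero _).1 h0))
  have hdvd : ¬ n + 2 ∣ (toAdd g).val := fun hd ↦
    ha (Nat.eq_zero_of_dvd_of_lt hd (ZMod.val_lt _))
  exact permMap_finRotate_pow_ne hp hm hdvd x h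

/-- Freeness of any diagonal action `g • (y, t) = (g • y, g • t)` with the Fermat factor.
[cite: Serre1964Conjugate, no. 2 (p. 4195)] -/
theorem fermatShift_prod_eq_one_of_smul_eq (hp : (n + 2).Prime) (hm : n + 2 ∣ m) {T : Type*}
    [MulAction (Multiplicative (ZMod (n + 2))) T] (g : Multiplicative (ZMod (n + 2)))
    (z : ComplexPoints (fermatHypersurface n m) × T) (h : g • z = z) : g = 1 :=
  fermatShift_eq_one_of_smul_eq hp hm g z.1 (congrArg Prod.fst h)

/-- `|ℤ/(n+2)| = n + 2`. [folklore] -/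
theorem natCard_multiplicative_zmod (n : ℕ) : Nat.card (Multiplicative (ZMod (n + 2))) = n + 2 := by
  rw [Nat.card_eq_fintype_card, Fintype.card_multiplicative, ZMod.card]

/-! ### `Y(ℂ)` is compact Hausdorff -/

/-- `Y(ℂ)` is compact for the Fermat hypersurface in `ℙⁿ⁺¹_ℂ` of degree `m` (`n, m ≥ 1`: it is
smooth projective, `isSmoothProjective_fermatHypersurface`). [cite: Serre1964Conjugate, no. 2 (p. 4195)] -/
theorem compactSpace_complexPoints_fermatHypersurface (hn : 1 ≤ n) (hm : 1 ≤ m) :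
    CompactSpace (ComplexPoints (fermatHypersurface n m)) :=
  ComplexPoints.compactSpace_of_isSmoothProjective (isSmoothProjective_fermatHypersurface hn hm)

/-- `Y(ℂ)` is Hausdorff. [cite: Serre1964Conjugate, no. 2 (p. 4195)] -/
theorem t2Space_complexPoints_fermatHypersurface (hn : 1 ≤ n) (hm : 1 ≤ m) :
    T2Space (ComplexPoints (fermatHypersurface n m)) :=
  ComplexPoints.t2Space_of_isSmoothProjective (isSmoothProjective_fermatHypersurface hn hm)

/-- `Y(ℂ)` is locally compact. [folklore] -/
theorem locallyCompactSpace_complexPoints_fermatHypersurface (hn : 1 ≤ n) (hm : 1 ≤ m) :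
    LocallyCompactSpace (ComplexPoints (fermatHypersurface n m)) := by
  haveI := compactSpace_complexPoints_fermatHypersurface hn hm
  haveI := t2Space_complexPoints_fermatHypersurface hn hm
  infer_instance

/-! ### The barrier fact from lattice models over Serre's `Y` -/

section Fact

open NumberField IntermediateField Literature.AlgebraicTopology.FundamentalGroup

/-- **Serre 1964 for `p = 23` with Serre's own `Y`.** As
`serre1964_twentyThree_of_latticeModels`, with both factors `Y₁ = Y₂ = Y(ℂ)` the complex points of
the Fermat hypersurface `Σ_{i<23} xᵢ²³ = 0 ⊂ ℙ²²_ℂ` and `G = ℤ/23` acting by the cyclic shift of the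
coordinates (`fermatShiftAction 21 23`; free by `fermatShift_eq_one_of_smul_eq`, continuous,
`Y(ℂ)` compact Hausdorff): if `V_φ(ℂ) ≃ₜ (Y(ℂ) × V₁/L₁)/G` and `V_ψ(ℂ) ≃ₜ (Y(ℂ) × V₂/L₂)/G` for a
smooth projective `V` over a number field, tori with `L₁ ≅ 𝓞 K`, `L₂ ≅ 𝔭·𝓞 K` on which a
generator acts through linear maps restricting to multiplication by `ζ₂₃`, then
`Serre1964_conjugateVarieties_notHomeomorphic` holds — granted the SIMPLE CONNECTIVITY of `Y(ℂ)`
("sur le corps `ℂ`, c'est un espace simplement connexe, en vertu d'un théorème de Lefschetz",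
the hypothesis `hY`). [cite: Serre1964Conjugate, nos. 1–2 and Théorème p. 4196] -/
theorem serre1964_twentyThree_of_fermatLatticeModels
    {K : Type*} [Field K] [NumberField K] [IsCyclotomicExtension {23} ℚ K] {ζ : K}
    (hζ : IsPrimitiveRoot ζ 23) {ω : K} (hω : ω ^ 2 = ω - 6) (w : 𝓞 ℚ⟮ω⟯)
    (hw : (w : ℚ⟮ω⟯) = AdjoinSimple.gen ℚ ω)
    (hY : SimplyConnectedSpace (ComplexPoints (fermatHypersurface 21 23)))
    -- torus 1
    {V₁ : Type*} [NormedAddCommGroup V₁] [NormedSpace ℝ V₁] [FiniteDimensional ℝ V₁]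
    (L₁ : Submodule ℤ V₁) [DiscreteTopology L₁] (M₁ : V₁ →ₗ[ℝ] V₁) (hM₁ : ∀ v ∈ L₁, M₁ v ∈ L₁)
    (ε₁ : 𝓞 K ≃+ L₁.toAddSubgroup)
    (hε₁ : ∀ s : 𝓞 K, ((ε₁ (hζ.toInteger * s) : L₁.toAddSubgroup) : V₁) = M₁ (ε₁ s))
    [MulAction (Multiplicative (ZMod 23)) (V₁ ⧸ L₁.toAddSubgroup)]
    [ContinuousConstSMul (Multiplicative (ZMod 23)) (V₁ ⧸ L₁.toAddSubgroup)]
    (g₁ : Multiplicative (ZMod 23))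
    (hg₁ : ∀ a : V₁ ⧸ L₁.toAddSubgroup, g₁⁻¹ • a = torusMap L₁.toAddSubgroup M₁.toAddMonoidHom
      M₁.continuous_of_finiteDimensional hM₁ a)
    -- torus 2
    {V₂ : Type*} [NormedAddCommGroup V₂] [NormedSpace ℝ V₂] [FiniteDimensional ℝ V₂]
    (L₂ : Submodule ℤ V₂) [DiscreteTopology L₂] (M₂ : V₂ →ₗ[ℝ] V₂) (hM₂ : ∀ v ∈ L₂, M₂ v ∈ L₂)
    (ε₂ : ↥((Ideal.span {(2 : 𝓞 ℚ⟮ω⟯), w}).map (algebraMap (𝓞 ℚ⟮ω⟯) (𝓞 K))) ≃+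
      L₂.toAddSubgroup)
    (hε₂ : ∀ b : ↥((Ideal.span {(2 : 𝓞 ℚ⟮ω⟯), w}).map (algebraMap (𝓞 ℚ⟮ω⟯) (𝓞 K))),
      ((ε₂ (hζ.toInteger • b) : L₂.toAddSubgroup) : V₂) = M₂ (ε₂ b))
    [MulAction (Multiplicative (ZMod 23)) (V₂ ⧸ L₂.toAddSubgroup)]
    [ContinuousConstSMul (Multiplicative (ZMod 23)) (V₂ ⧸ L₂.toAddSubgroup)]
    (g₂ : Multiplicative (ZMod 23))
    (hg₂ : ∀ a : V₂ ⧸ L₂.toAddSubgroup, g₂⁻¹ • a = torusMap L₂.toAddSubgroup M₂.toAddMonoidHom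
      M₂.continuous_of_finiteDimensional hM₂ a)
    -- the variety and the two homeomorphisms with the models
    {H : Type} [Field H] [NumberField H] {n : ℕ} {V : SchemeOver H} (hV : IsSmoothProjective n V)
    (φ ψ : H →+* ℂ)
    (eφ : ComplexPoints ((baseChangeHom φ).obj V) ≃ₜ MulAction.orbitRel.Quotient
      (Multiplicative (ZMod 23)) (ComplexPoints (fermatHypersurface 21 23) × (V₁ ⧸ L₁.toAddSubgroup)))
    (eψ : ComplexPoints ((baseChangeHom ψ).obj V) ≃ₜ MulAction.orbitRel.Quotient
      (Multiplicative (ZMod 23)) (ComplexPoints (fermatHypersurface 21 23) × (V₂ ⧸ L₂.toAddSubgroup))) :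
    Serre1964_conjugateVarieties_notHomeomorphic := by
  haveI := hY
  haveI := locallyCompactSpace_complexPoints_fermatHypersurface (n := 21) (m := 23) (by norm_num)
    (by norm_num)
  haveI := t2Space_complexPoints_fermatHypersurface (n := 21) (m := 23) (by norm_num) (by norm_num)
  have hp : (21 + 2).Prime := by norm_num
  exact serre1964_twentyThree_of_latticeModels hζ hω w hw L₁ M₁ hM₁ ε₁ hε₁
    (natCard_multiplicative_zmod 21)
    (fun g z h ↦ fermatShift_prod_eq_one_of_smul_eq hp (dvd_refl _) g z h) g₁ hg₁ L₂ M₂ hM₂ ε₂ hε₂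
    (natCard_multiplicative_zmod 21)
    (fun g z h ↦ fermatShift_prod_eq_one_of_smul_eq hp (dvd_refl _) g z h) g₂ hg₂ hV φ ψ eφ eψ

end Fact

end Literature.Barriers.HodgeConjecture.Serre1964

end
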